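import Literature.NumberTheory.EllipticCurves.BSDSelmerParityDokchitserBaseChangeProofs
import Literature.NumberTheory.EllipticCurves.SelmerTorsionRestriction
import Literature.NumberTheory.EllipticCurves.LocalKummerIsotropyTransport
import HarnessLib

/-!
# The twist side of Gross's decomposition at finite level:
# `Sel_p(E^{(d_K)}/ℚ) ↪ Sel_p(E/K)^-` for a quadratic field `K` and an odd prime `p`

Companion of `SelmerTorsionRestriction` (`Sel_p(E/ℚ) ↪ Sel_p(E/K)^+`) and the finite-level
(`E[n]`-coefficients) twin of the twist machinery of `QuadraticTwistSelmerPInfty` /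
`BSDSelmerParityDokchitserBaseChangeProofs` (which treat `E[p^∞]`: `primaryIso`, `h1PrimaryIso`,
`psiK`, `hPsiK`, `psiQ`). For `E = W/ℚ`, a quadratic number field `K = ℚ(θ)`, `θ² = c`, with its
non-trivial automorphism `σ₀ = sigmaQ` (`σ₀ θ = -θ`):

* `torsionIso n hV : E₁[n](K̄) ≃+ E₂[n](K̄)` for `V • W₁ = W₂` over a field, the induced
  `h1TorsionIso : H¹(K, E₁[n]) ≃+ H¹(K, E₂[n])`, and the correspondence of the Selmer local
  conditions / of `Sel^(n)` (`mem_selmerLocalKer_iff_h1TorsionIso_mem`,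
  `mem_selmerGroup_iff_h1TorsionIso_mem`; Silverman X.§4: Selmer groups are attached to `E/K`),
  whence `natCard_selmerGroup_eq_of_variableChange`;
* `psiKT`, `hPsiKT` — the twist isomorphism `E^{(c)}_K[n](K̄) ≃+ E_K[n](K̄)` (restriction of
  `twistIso`) and the induced `H¹(K, E^{(c)}_K[n]) ≃+ H¹(K, E_K[n])`, respecting `Sel^(n)`
  (`mem_selmerGroup_iff_hPsiKT_mem`);
* `psiQT` — the same isomorphism in the `Γ_ℚ`-world `E^{(c)}[n](ℚ̄) ≃+ E[n](ℚ̄)`,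
  `galRange K`-equivariant (`psiQT_smul`) and ANTI-equivariant at the transported lift `c₀` of
  `σ₀` (`psiQT_smul_liftToAbsGal`: the sign rule `twistIso (τ₀ P) = -(τ₀ (twistIso P))`,
  T. Dokchitser 2013 §4 "`E_α ≅ E` over `K(√α)` with the Galois action twisted by the quadratic
  character"); compatibility with the subgroup models (`h1Equiv_psiQT_modelIsoTorsion`);
* **the sign on `H¹`** (`conjAct_hPsiKT`): `σ₀ · hPsiKT y = -(hPsiKT (σ₀ · y))` — in the subgroup
  model this is the tree's `h1Equiv_conjH1_neg`;
* hence, for `x ∈ Sel^(n)(E^{(c)}/ℚ)`, the class `hPsiKT (res x)` lies in `Sel^(n)(E_K/K)` with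
  `σ₀`-eigenvalue `-1` (`hPsiKT_resTorsion_mem_selmerGroup_and_conjAct_eq`), and for an odd prime
  `p` the map `x ↦ hPsiKT (res x)` is injective (`resTorsion_injective_of_odd`), so
  **`#Sel_p(E^{(c)}/ℚ) ≤ #T` for every finite `T ⊇ Sel_p(E/K)^-`**
  (`natCard_selmerGroup_quadraticTwist_le_of_forall_mem`); and the same for the twist by the
  DISCRIMINANT `E^{(d_K)}` and ANY non-trivial `σ ∈ Aut(K/ℚ)`
  (`natCard_selmerGroup_quadraticTwist_discr_le_of_forall_mem`: `d_K = c q²`,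
  `NumberField.exists_discr_eq_mul_sq`, so `E^{(d_K)} ≅ E^{(c)}` over `ℚ`; `Aut(K/ℚ) = {1, σ₀}`).

This is the `−`-half of Gross 1991, §5 (5.1) (`Sel(E/K)_p = Sel(E/K)_p^+ ⊕ Sel(E/K)_p^-` with
`Sel(E/ℚ)_p ↪ Sel^+`, `Sel(E^{(D)}/ℚ)_p ↪ Sel^-`), used by the BSD route `KolyvaginDepthDoor` to read
Kolyvagin's second eigen-Selmer bound `#Sel(E/K)_p^{-ε} ≤ p^{ν}` on the twist over `ℚ`. Everything
here is proved; no named fact is introduced. `K : Type` (universe discipline of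
`SelmerPInftyModelAction`).

## References

* B. H. Gross, *Kolyvagin's work on modular elliptic curves*, LMS LNS 153 (1991), §5 (5.1).
  [GrossLMS1991]
* T. Dokchitser, *Notes on the parity conjecture* (2013), §4. [Dokchitser2013ParityNotes]
* T. Dokchitser, V. Dokchitser, Ann. of Math. 172 (2010), Lemma 4.14. [DokchitserDokchitserAnnals2010]
* J. H. Silverman, *The Arithmetic of Elliptic Curves*, 2nd ed. (2009), X.2 Prop. 2.4, X.§4,
  X.5 Cor. 5.4. [SilvermanAEC2009]
-/

noncomputable section

open scoped Classical

universe u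

namespace Literature.NumberTheory.EllipticCurves

open GaloisRepresentations WeierstrassCurve Literature.NumberTheory.QuadraticFields

/-! ## `Sel^(n)` local conditions under an isomorphism of curves over `K` -/

section Iso

variable {K : Type u} [Field K] {W₁ W₂ : WeierstrassCurve K} {V : VariableChange K} (n : ℤ)

/-- The isomorphism `E₁[n] ≃+ E₂[n]` induced by `V • W₁ = W₂` (restriction of `twistPointsIso`
to `n`-torsion, through the tree's `torsionByCongr`). [cite: SilvermanAEC2009, III.3.1(b)] -/
def torsionIso (hV : V • W₁ = W₂) : geomTorsion W₁ n ≃+ geomTorsion W₂ n :=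
  torsionByCongr (twistPointsIso hV) n

/-- `torsionIso` is `Γ_K`-equivariant. [cite: SilvermanAEC2009, X.§4] -/
theorem torsionIso_smul (hV : V • W₁ = W₂) (g : Field.absoluteGaloisGroup K)
    (P : geomTorsion W₁ n) : torsionIso n hV (g • P) = g • torsionIso n hV P :=
  Subtype.ext (by
    rw [torsionIso, coe_torsionByCongr_apply, AddSubgroup.torsionBy.coe_smul,
      AddSubgroup.torsionBy.coe_smul, coe_torsionByCongr_apply, twistPointsIso_smul])

/-- **`H¹(K, E₁[n]) ≃+ H¹(K, E₂[n])`** induced by the `Γ_K`-equivariant `torsionIso`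
(`h1Equiv`). [cite: SilvermanAEC2009, X.§4] -/
def h1TorsionIso (hV : V • W₁ = W₂) : galH1Torsion W₁ n ≃+ galH1Torsion W₂ n :=
  h1Equiv (torsionIso n hV) (torsionIso_smul n hV)

variable (E : Type u) [Field E] [Algebra K E]

/-- **The `n`-Selmer local conditions of isomorphic curves correspond** at every `K`-field `E`
(`mem_resKer_iff_h1Equiv_mem` applied to the local square `pointsMap_twistPointsIso`).
[cite: SilvermanAEC2009, X.§4] -/
theorem mem_selmerLocalKer_iff_h1TorsionIso_mem (hV : V • W₁ = W₂) (s : galH1Torsion W₁ n) :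
    s ∈ selmerLocalKer W₁ E n ↔ h1TorsionIso n hV s ∈ selmerLocalKer W₂ E n :=
  mem_resKer_iff_h1Equiv_mem (resGal (K := K) E)
    ((pointsMap W₁ E).comp (geomTorsion W₁ n).subtype) _
    ((pointsMap W₂ E).comp (geomTorsion W₂ n).subtype) _
    (torsionIso n hV) (torsionIso_smul n hV) (twistLocalIso E hV) (twistLocalIso_smul E hV)
    (fun m ↦ pointsMap_twistPointsIso E hV (m : geomPoints W₁)) s

end Iso

section IsoNumberField

open NumberField IsDedekindDomain

variable {K : Type u} [Field K] [NumberField K] {W₁ W₂ : WeierstrassCurve K} {V : VariableChange K}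
  (n : ℤ)

/-- **Isomorphic curves have corresponding `n`-Selmer groups** (place by place).
[cite: SilvermanAEC2009, X.§4] -/
theorem mem_selmerGroup_iff_h1TorsionIso_mem (hV : V • W₁ = W₂) (s : galH1Torsion W₁ n) :
    s ∈ selmerGroup W₁ n ↔ h1TorsionIso n hV s ∈ selmerGroup W₂ n := by
  simp only [WeierstrassCurve.selmerGroup, AddSubgroup.mem_inf, AddSubgroup.mem_iInf]
  refine and_congr (forall_congr' fun v ↦ ?_) (forall_congr' fun w ↦ ?_)
  · exact mem_selmerLocalKer_iff_h1TorsionIso_mem n _ hV s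
  · exact mem_selmerLocalKer_iff_h1TorsionIso_mem n _ hV s

/-- **Isomorphic curves have `n`-Selmer groups of the same order** (`h1TorsionIso` restricts to a
bijection `Sel^(n)(W₁) ≃ Sel^(n)(W₂)`). [cite: SilvermanAEC2009, X.§4] -/
theorem natCard_selmerGroup_eq_of_variableChange (hV : V • W₁ = W₂) :
    Nat.card ↥(selmerGroup W₁ n) = Nat.card ↥(selmerGroup W₂ n) := by
  refine Nat.card_congr
    { toFun := fun s ↦ ⟨h1TorsionIso n hV s, (mem_selmerGroup_iff_h1TorsionIso_mem n hV s.1).mp s.2⟩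
      invFun := fun t ↦ ⟨(h1TorsionIso n hV).symm t, by
        have h := mem_selmerGroup_iff_h1TorsionIso_mem n hV ((h1TorsionIso n hV).symm t.1)
        rw [AddEquiv.apply_symm_apply] at h
        exact h.mpr t.2⟩
      left_inv := fun s ↦ Subtype.ext ((h1TorsionIso n hV).symm_apply_apply s.1)
      right_inv := fun t ↦ Subtype.ext ((h1TorsionIso n hV).apply_symm_apply t.1) }

end IsoNumberField

/-! ## The setting: `E/ℚ`, `K = ℚ(θ)` quadratic with `θ² = c`, index `n` -/

section Setting

variable (W : WeierstrassCurve ℚ) (K : Type) [Field K] [NumberField K] (h2 : Module.finrank ℚ K = 2)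
  {θ : K} {c : ℚ} (hθ : θ ∉ Set.range (algebraMap ℚ K)) (hc : θ ^ 2 = algebraMap ℚ K c) (n : ℤ)

/-- The `K`-level twist isomorphism `E^{(c)}_K[n] ≃+ E_K[n]` (restriction of `twistIso` to
`n`-torsion, as the composite of the two single changes of variables; twin of `psiK`).
[cite: SilvermanAEC2009, X.5 Cor. 5.4] -/
def psiKT : geomTorsion ((W.quadraticTwist c).baseChange K) n ≃+ geomTorsion (W.baseChange K) n :=
  (torsionIso n (twistUntwist_smul_baseChange W hθ hc)).trans
    (torsionIso n (map_smul_baseChange_eq_quadraticTwist_one W (sqChange_spec W) (K := K))).symm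

/-- `psiKT` is `twistIso` on underlying points. [cite: SilvermanAEC2009, X.5 Cor. 5.4] -/
theorem coe_psiKT (m : geomTorsion ((W.quadraticTwist c).baseChange K) n) :
    (psiKT W K hθ hc n m : geomPoints (W.baseChange K)) = twistIso W hθ hc (sqChange_spec W) m :=
  rfl

/-- `psiKT` is `Γ_K`-equivariant. [cite: SilvermanAEC2009, X.§4] -/
theorem psiKT_smul (g : Field.absoluteGaloisGroup K)
    (m : geomTorsion ((W.quadraticTwist c).baseChange K) n) :
    psiKT W K hθ hc n (g • m) = g • psiKT W K hθ hc n m :=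
  Subtype.ext (by
    rw [coe_psiKT, AddSubgroup.torsionBy.coe_smul, AddSubgroup.torsionBy.coe_smul, coe_psiKT,
      twistIso_smul])

/-- The `K`-level twist isomorphism on `H¹(K, ·[n])` (composite of the two `h1TorsionIso`; twin
of `hPsiK`). [cite: SilvermanAEC2009, X.§4] -/
def hPsiKT : galH1Torsion ((W.quadraticTwist c).baseChange K) n ≃+ galH1Torsion (W.baseChange K) n :=
  (h1TorsionIso n (twistUntwist_smul_baseChange W hθ hc)).trans
    (h1TorsionIso n (map_smul_baseChange_eq_quadraticTwist_one W (sqChange_spec W) (K := K))).symm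

/-- `hPsiKT` as one map of pairs: `resH1Hom (id, psiKT)`.
[cite: SerreGaloisCohomology1997, I.§2.4 (compatible pairs)] -/
theorem hPsiKT_apply (s : galH1Torsion ((W.quadraticTwist c).baseChange K) n) :
    hPsiKT W K hθ hc n s = resH1Hom (ContinuousMonoidHom.id _)
      (psiKT W K hθ hc n).toAddMonoidHom (psiKT_smul W K hθ hc n) s := by
  rw [hPsiKT, AddEquiv.trans_apply, h1TorsionIso, h1TorsionIso]
  change resH1Hom (ContinuousMonoidHom.id _) _ _ (h1Equiv _ _ s) = _
  rw [h1Equiv_apply, resH1Hom_resH1Hom]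
  exact congrFun (congrArg DFunLike.coe (resH1Hom_congr (by ext; rfl) (by ext; rfl) _ _)) s

/-- `hPsiKT` respects `Sel^(n)`: `s ∈ Sel^(n)(E^{(c)}_K/K) ↔ hPsiKT s ∈ Sel^(n)(E_K/K)`.
[cite: SilvermanAEC2009, X.§4] -/
theorem mem_selmerGroup_iff_hPsiKT_mem (s : galH1Torsion ((W.quadraticTwist c).baseChange K) n) :
    s ∈ selmerGroup ((W.quadraticTwist c).baseChange K) n ↔
      hPsiKT W K hθ hc n s ∈ selmerGroup (W.baseChange K) n := by
  rw [hPsiKT, AddEquiv.trans_apply,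
    mem_selmerGroup_iff_h1TorsionIso_mem n (twistUntwist_smul_baseChange W hθ hc) s,
    mem_selmerGroup_iff_h1TorsionIso_mem n
      (map_smul_baseChange_eq_quadraticTwist_one W (sqChange_spec W) (K := K)),
    AddEquiv.apply_symm_apply]

/-- **The twist isomorphism `ψ : E^{(c)}[n](ℚ̄) ≃+ E[n](ℚ̄)`** in the `Γ_ℚ`-world: through the
coefficient isomorphisms `torsionBaseChangeEquiv` it is `psiKT` (twin of `psiQ`).
[cite: SilvermanAEC2009, X.5 Cor. 5.4] -/
def psiQT : geomTorsion (W.quadraticTwist c) n ≃+ geomTorsion W n :=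
  haveI : Algebra.IsAlgebraic ℚ K := Algebra.IsAlgebraic.of_finite ℚ K
  (torsionBaseChangeEquiv K (W.quadraticTwist c) n).trans
    ((psiKT W K hθ hc n).trans (torsionBaseChangeEquiv K W n).symm)

/-- Unfolding `psiQT`. [cite: SilvermanAEC2009, X.5 Cor. 5.4] -/
theorem psiQT_apply (m' : geomTorsion (W.quadraticTwist c) n) :
    haveI : Algebra.IsAlgebraic ℚ K := Algebra.IsAlgebraic.of_finite ℚ K
    psiQT W K hθ hc n m' = (torsionBaseChangeEquiv K W n).symm
      (psiKT W K hθ hc n (torsionBaseChangeEquiv K (W.quadraticTwist c) n m')) :=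
  rfl

/-- **`ψ` is `galRange K`-equivariant** (`galRange K ≅ Γ_K` acts through `Γ_K`, and `psiKT` is
`Γ_K`-equivariant). [cite: SerreGaloisCohomology1997, I.§2.4 (compatible pairs)] -/
theorem psiQT_smul (g : galRange (K := ℚ) K) (m' : geomTorsion (W.quadraticTwist c) n) :
    psiQT W K hθ hc n (g • m') = g • psiQT W K hθ hc n m' := by
  haveI : Algebra.IsAlgebraic ℚ K := Algebra.IsAlgebraic.of_finite ℚ K
  rw [psiQT_apply, psiQT_apply, ← resGalToRange_rangeToResGal K g, torsionBaseChangeEquiv_smul,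
    psiKT_smul, resGalToRange_rangeToResGal, ← torsionBaseChangeEquiv_symm_smul]

/-- **`ψ` is anti-equivariant at the transported lift `c₀` of `σ₀`**: `ψ (c₀ • m') = -(c₀ • ψ m')`
— the sign rule `twistIso (τ₀ P) = -(τ₀ (twistIso P))` (`twistIso_pointsMap_of_neg`, `σ₀ θ = -θ`)
read through the coefficient isomorphisms (`torsionBaseChangeEquiv_smul_liftToAbsGal`); twin of
`psiQ_smul_liftToAbsGal`.
[cite: Dokchitser2013ParityNotes, §4, proof of the Theorem "[Squarity, NekIV, Kurast]"] -/
theorem psiQT_smul_liftToAbsGal (m' : geomTorsion (W.quadraticTwist c) n) :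
    psiQT W K hθ hc n (liftToAbsGal (K := ℚ) K (sigmaQ K h2 hθ hc) • m') =
      -(liftToAbsGal (K := ℚ) K (sigmaQ K h2 hθ hc) • psiQT W K hθ hc n m') := by
  haveI : Algebra.IsAlgebraic ℚ K := Algebra.IsAlgebraic.of_finite ℚ K
  apply (torsionBaseChangeEquiv K W n).injective
  rw [psiQT_apply, AddEquiv.apply_symm_apply, ← torsionBaseChangeEquiv_smul_liftToAbsGal, map_neg,
    ← torsionBaseChangeEquiv_smul_liftToAbsGal, psiQT_apply, AddEquiv.apply_symm_apply]
  apply Subtype.ext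
  rw [coe_psiKT, IsLiftOfAut.coe_torsionMap, NegMemClass.coe_neg, IsLiftOfAut.coe_torsionMap,
    coe_psiKT]
  exact twistIso_pointsMap_of_neg W hθ hc (sqChange_spec W) (isLiftOfAut_liftAut _)
    (sigmaQ_gen K h2 hθ hc) _

/-- **`ψ_* ∘ modelIsoTorsion' = modelIsoTorsion ∘ hPsiKT`** on `H¹(K, E^{(c)}_K[n])` (both are the
map of the pair `(rangeToResGal, ψ ∘ ι'⁻¹ = ι⁻¹ ∘ psiKT)`); twin of `h1Equiv_psiQ_modelIso`.
[cite: SerreGaloisCohomology1997, I.§2.4 (compatible pairs)] -/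
theorem h1Equiv_psiQT_modelIsoTorsion (y : galH1Torsion ((W.quadraticTwist c).baseChange K) n) :
    haveI : Algebra.IsAlgebraic ℚ K := Algebra.IsAlgebraic.of_finite ℚ K
    h1Equiv (psiQT W K hθ hc n) (psiQT_smul W K hθ hc n)
        (modelIsoTorsion K (W.quadraticTwist c) n y) =
      modelIsoTorsion K W n (hPsiKT W K hθ hc n y) := by
  haveI : Algebra.IsAlgebraic ℚ K := Algebra.IsAlgebraic.of_finite ℚ K
  rw [h1Equiv_apply, modelIsoTorsion_apply, modelIsoTorsion_apply, hPsiKT_apply, resH1Hom_resH1Hom,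
    resH1Hom_resH1Hom]
  refine congrFun (congrArg DFunLike.coe (resH1Hom_congr (by ext; rfl) ?_ _ _)) y
  refine AddMonoidHom.ext fun m ↦ ?_
  change psiQT W K hθ hc n ((torsionBaseChangeEquiv K (W.quadraticTwist c) n).symm m) =
    (torsionBaseChangeEquiv K W n).symm (psiKT W K hθ hc n m)
  rw [psiQT_apply, AddEquiv.apply_symm_apply]

/-- **The sign on `H¹`**: `σ₀ · (hPsiKT y) = -(hPsiKT (σ₀ · y))` for every
`y ∈ H¹(K, E^{(c)}_K[n])` — the actions `conjAct` of `σ₀` on the two sides (file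
`SelmerGaloisAction`) differ by the quadratic character under the twist isomorphism. Proof in the
subgroup models (`modelIsoTorsion_conjAct` on both curves, `h1Equiv_psiQT_modelIsoTorsion`, and the
tree's `h1Equiv_conjH1_neg` for the anti-equivariant `ψ`).
[cite: Dokchitser2013ParityNotes, §4, proof of the Theorem "[Squarity, NekIV, Kurast]"]
[cite: GrossLMS1991, §5 (5.1)] -/
theorem conjAct_hPsiKT (y : galH1Torsion ((W.quadraticTwist c).baseChange K) n) :
    conjAct W (sigmaQ K h2 hθ hc) n (hPsiKT W K hθ hc n y) =
      -(hPsiKT W K hθ hc n (conjAct (W.quadraticTwist c) (sigmaQ K h2 hθ hc) n y)) := by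
  haveI : Algebra.IsAlgebraic ℚ K := Algebra.IsAlgebraic.of_finite ℚ K
  haveI : IsGalois ℚ K := isGalois_of_finrank_eq_two K h2
  have hσ₀ := sigmaQ_ne_one K h2 hθ hc
  haveI := normal_galRange K h2 hσ₀
  apply (modelIsoTorsion K W n).injective
  rw [modelIsoTorsion_conjAct K W n _ h2 hσ₀, map_neg, ← h1Equiv_psiQT_modelIsoTorsion,
    ← h1Equiv_psiQT_modelIsoTorsion, modelIsoTorsion_conjAct K (W.quadraticTwist c) n _ h2 hσ₀,
    h1Equiv_conjH1_neg (psiQT W K hθ hc n) (psiQT_smul W K hθ hc n)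
      (psiQT_smul_liftToAbsGal W K h2 hθ hc n), neg_neg]

/-- **`x ↦ hPsiKT (res x)` carries `Sel^(n)(E^{(c)}/ℚ)` into the `−1`-eigenspace of
`Sel^(n)(E_K/K)`**: for `x ∈ Sel^(n)(E^{(c)}/ℚ)`, `res x ∈ Sel^(n)(E^{(c)}_K/K)` is fixed by `σ₀`
(`resTorsion_mem_selmerGroup_and_conjAct_eq`), so `hPsiKT (res x) ∈ Sel^(n)(E_K/K)`
(`mem_selmerGroup_iff_hPsiKT_mem`) and `σ₀ · hPsiKT (res x) = (-1) • hPsiKT (res x)`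
(`conjAct_hPsiKT`). This is `Sel(E^{(D)}/ℚ)_p ↪ Sel(E/K)_p^-` of Gross 1991, §5 (5.1).
[cite: GrossLMS1991, §5 (5.1)] -/
theorem hPsiKT_resTorsion_mem_selmerGroup_and_conjAct_eq
    {x : galH1Torsion (W.quadraticTwist c) n} (hx : x ∈ selmerGroup (W.quadraticTwist c) n) :
    hPsiKT W K hθ hc n (resTorsion (W.quadraticTwist c) K n x) ∈ selmerGroup (W.baseChange K) n ∧
      conjAct W (sigmaQ K h2 hθ hc) n (hPsiKT W K hθ hc n (resTorsion (W.quadraticTwist c) K n x)) =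
        (-1 : ℤ) • hPsiKT W K hθ hc n (resTorsion (W.quadraticTwist c) K n x) := by
  haveI : IsGalois ℚ K := isGalois_of_finrank_eq_two K h2
  obtain ⟨hmem, hfix⟩ := resTorsion_mem_selmerGroup_and_conjAct_eq (W.quadraticTwist c) n
    (sigmaQ K h2 hθ hc) h2 (sigmaQ_ne_one K h2 hθ hc) hx
  rw [one_zsmul] at hfix
  refine ⟨(mem_selmerGroup_iff_hPsiKT_mem W K hθ hc n _).mp hmem, ?_⟩
  rw [conjAct_hPsiKT W K h2 hθ hc n, hfix, neg_one_zsmul]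

/-- **`#Sel_p(E^{(c)}/ℚ) ≤ #T` for any finite subgroup `T ⊆ H¹(K, E[p])` containing the `−1`-eigen
Selmer classes** (`p` an odd prime, `K = ℚ(θ)`, `θ² = c`): `x ↦ hPsiKT (res x)` is injective
(`resTorsion_injective_of_odd` for `E^{(c)}`, `hPsiKT` an isomorphism) with values in
`{s ∈ Sel_p(E/K) : σ₀ · s = (-1) • s} ⊆ T`. [cite: GrossLMS1991, §5 (5.1)] -/
theorem natCard_selmerGroup_quadraticTwist_le_of_forall_mem {p : ℕ} (hp : p.Prime) (hp2 : p ≠ 2)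
    (T : AddSubgroup (galH1Torsion (W.baseChange K) (p : ℤ))) [Finite T]
    (hT : ∀ s ∈ selmerGroup (W.baseChange K) (p : ℤ),
      conjAct W (sigmaQ K h2 hθ hc) (p : ℤ) s = (-1 : ℤ) • s → s ∈ T) :
    Finite (selmerGroup (W.quadraticTwist c) (p : ℤ)) ∧
      Nat.card (selmerGroup (W.quadraticTwist c) (p : ℤ)) ≤ Nat.card T := by
  haveI : IsGalois ℚ K := isGalois_of_finrank_eq_two K h2
  let f : selmerGroup (W.quadraticTwist c) (p : ℤ) → T := fun x ↦
    ⟨hPsiKT W K hθ hc (p : ℤ) (resTorsion (W.quadraticTwist c) K (p : ℤ) x),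
      hT _ (hPsiKT_resTorsion_mem_selmerGroup_and_conjAct_eq W K h2 hθ hc (p : ℤ) x.2).1
        (hPsiKT_resTorsion_mem_selmerGroup_and_conjAct_eq W K h2 hθ hc (p : ℤ) x.2).2⟩
  have hf : Function.Injective f := fun a b h ↦ Subtype.ext
    (resTorsion_injective_of_odd K (W.quadraticTwist c) (sigmaQ K h2 hθ hc) h2
      (sigmaQ_ne_one K h2 hθ hc) hp hp2 ((hPsiKT W K hθ hc (p : ℤ)).injective (congrArg Subtype.val h)))
  exact ⟨Finite.of_injective f hf, Nat.card_le_card_of_injective f hf⟩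

end Setting

/-! ## The twist by the discriminant and an arbitrary non-trivial automorphism -/

section Discr

variable (W : WeierstrassCurve ℚ) (K : Type) [Field K] [NumberField K] (h2 : Module.finrank ℚ K = 2)
  (σ : K ≃ₐ[ℚ] K) (hσ : σ ≠ 1)

include h2 hσ in
/-- In a quadratic field the non-trivial automorphism is unique: `σ ≠ 1` is the conjugation
`sigmaQ` of any square-root generator (`#Aut(K/ℚ) = [K : ℚ] = 2`). [cite: GrossLMS1991, §5] -/
theorem eq_sigmaQ_of_ne_one {θ : K} {c : ℚ} (hθ : θ ∉ Set.range (algebraMap ℚ K))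
    (hc : θ ^ 2 = algebraMap ℚ K c) : σ = sigmaQ K h2 hθ hc := by
  haveI : IsGalois ℚ K := isGalois_of_finrank_eq_two K h2
  have hcard : Nat.card (K ≃ₐ[ℚ] K) = 2 := by rw [IsGalois.card_aut_eq_finrank, h2]
  haveI : Finite (K ≃ₐ[ℚ] K) := Nat.finite_of_card_ne_zero (by rw [hcard]; decide)
  by_contra hne
  have h3 : 3 ≤ Nat.card (K ≃ₐ[ℚ] K) := by
    have hsub : ({1, σ, sigmaQ K h2 hθ hc} : Finset (K ≃ₐ[ℚ] K)).card ≤ Nat.card (K ≃ₐ[ℚ] K) := by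
      rw [Nat.card_eq_fintype_card]
      exact Finset.card_le_univ _
    have h1σ : (1 : K ≃ₐ[ℚ] K) ≠ σ := fun h ↦ hσ h.symm
    have h1τ : (1 : K ≃ₐ[ℚ] K) ≠ sigmaQ K h2 hθ hc := fun h ↦ sigmaQ_ne_one K h2 hθ hc h.symm
    rw [Finset.card_insert_of_notMem (by simp [h1σ, h1τ]),
      Finset.card_insert_of_notMem (by simp [hne]), Finset.card_singleton] at hsub
    exact hsub
  omega

include h2 hσ in
/-- **`#Sel_p(E^{(d_K)}/ℚ) ≤ #T` for every finite `T ⊇ Sel_p(E/K)^-`**, `K` any quadratic number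
field, `σ ≠ 1` in `Aut(K/ℚ)`, `p` an odd prime, `−`-eigenspace taken for `conjAct W σ p`: write
`K = ℚ(θ)`, `θ² = c` (`Quadratic.exists_sq_eq_algebraMap`), `σ = σ₀` (`eq_sigmaQ_of_ne_one`),
`d_K = c q²` (`NumberField.exists_discr_eq_mul_sq`) so that `E^{(d_K)} ≅ E^{(c)}` over `ℚ`
(`exists_variableChange_quadraticTwist_mul_sq`, `natCard_selmerGroup_eq_of_variableChange`), and
apply `natCard_selmerGroup_quadraticTwist_le_of_forall_mem`. Used by the BSD route
`KolyvaginDepthDoor` to read Kolyvagin's bound on the other eigenspace, `#Sel(E/K)_p^{-} ≤ p^{ν}`,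
as `#Sel_p(E^{(d_K)}/ℚ) ≤ p^{ν}`. [cite: GrossLMS1991, §5 (5.1)] -/
theorem natCard_selmerGroup_quadraticTwist_discr_le_of_forall_mem {p : ℕ} (hp : p.Prime)
    (hp2 : p ≠ 2) (T : AddSubgroup (galH1Torsion (W.baseChange K) (p : ℤ))) [Finite T]
    (hT : ∀ s ∈ selmerGroup (W.baseChange K) (p : ℤ),
      conjAct W σ (p : ℤ) s = (-1 : ℤ) • s → s ∈ T) :
    Finite (selmerGroup (W.quadraticTwist (NumberField.discr K : ℚ)) (p : ℤ)) ∧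
      Nat.card (selmerGroup (W.quadraticTwist (NumberField.discr K : ℚ)) (p : ℤ)) ≤ Nat.card T := by
  obtain ⟨θ, c, hθ, hc⟩ := Quadratic.exists_sq_eq_algebraMap (F := ℚ) (K := K) h2
  obtain ⟨q, hq, hd⟩ := NumberField.exists_discr_eq_mul_sq h2 hθ hc
  obtain ⟨C, hC⟩ := W.exists_variableChange_quadraticTwist_mul_sq c q hq
  rw [← hd] at hC
  have hσ' : σ = sigmaQ K h2 hθ hc := eq_sigmaQ_of_ne_one K h2 σ hσ hθ hc
  subst hσ'
  obtain ⟨hfin, hle⟩ := natCard_selmerGroup_quadraticTwist_le_of_forall_mem W K h2 hθ hc hp hp2 T hT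
  rw [natCard_selmerGroup_eq_of_variableChange (p : ℤ) hC] at hle
  haveI := hfin
  have hback : ∀ t : galH1Torsion (W.quadraticTwist (NumberField.discr K : ℚ)) (p : ℤ),
      t ∈ selmerGroup (W.quadraticTwist (NumberField.discr K : ℚ)) (p : ℤ) →
        (h1TorsionIso (p : ℤ) hC).symm t ∈ selmerGroup (W.quadraticTwist c) (p : ℤ) := fun t ht ↦ by
    have h := mem_selmerGroup_iff_h1TorsionIso_mem (p : ℤ) hC ((h1TorsionIso (p : ℤ) hC).symm t)
    rw [AddEquiv.apply_symm_apply] at h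
    exact h.mpr ht
  let g : selmerGroup (W.quadraticTwist (NumberField.discr K : ℚ)) (p : ℤ) →
      selmerGroup (W.quadraticTwist c) (p : ℤ) :=
    fun t ↦ ⟨(h1TorsionIso (p : ℤ) hC).symm t.1, hback t.1 t.2⟩
  have hg : Function.Injective g := fun a b h ↦
    Subtype.ext ((h1TorsionIso (p : ℤ) hC).symm.injective (congrArg Subtype.val h))
  exact ⟨Finite.of_injective g hg, hle⟩

end Discr

end Literature.NumberTheory.EllipticCurves
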